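import Mathlib.NumberTheory.Padics.PadicIntegers
import Mathlib.RingTheory.Polynomial.Cyclotomic.Roots
import Mathlib.RingTheory.Polynomial.GaussLemma
import Mathlib.RingTheory.PowerBasis
import Literature.AnabelianGeometry.AbsoluteAnabelian.GeneralizedSubpadicCyclotomicProofs
import HarnessLib

/-!
# Routes `ClassRecordThree` ∕ `KolyvaginRoadThree` (K2@3, KOLY), item 20262 `IMCDivTwoLociAtThreeR`
# (stub `stub_ub3_ratUpperDivisibility` = UB₃) — LEMMA I of the cell memo PROOF-BDP §53.2: the
# INJECTIVITY LEMMA at an exceptional (decomposition-trivial) character, kernel form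

Cell `bsd-stepL` (run/shared/lean/pub/bsd-stepL/), seat `bsd-stepL-bdp` (prover g22, 2026-08-27).
`--supports stmt-BirchSwinnertonDyer-20262 --as helper`. THEOREMS ONLY (no definition, no named fact,
no `sorry`); pure algebra (Mathlib + one Literature irreducibility theorem).

CONTEXT (memo §53). At a split Tate prime `p ∥ N` with decomposition group `D_𝔭 ⊊ Γ` in the
anticyclotomic tower, the Euler-system-side inclusion UB has to be settled POINTWISE at the exceptional
height-one primes `𝔓_ζ`, `ζ` a character of `Γ∕D_𝔭 = Gal(K^D∕K)` (`K^D` the decomposition field, in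
which `𝔭` splits completely). The one non-formal input there is: for `u ∈ E(K^D)` (the Heegner trace)
and ANY embedding `ι : K^D ↪ ℚ_p`, the `p`-adic period `Z_ι(ζ) = Σ_τ ζ(τ)·log_ω(ι(u^τ)) ∈ ℚ_p(ζ)`
VANISHES iff the `ζ̄`-component of `u` is torsion — with NO `p`-adic transcendence input, because all
conjugates `u^τ` lie in the one group `E(K^D)`, `log_ω ∘ ι` is injective on `E(K^D) ⊗ ℚ`, and
`1, ζ, …, ζ^{φ(p^j)−1}` stay linearly independent over `ℚ_p` (`p` is totally ramified in `ℚ(μ_{p^j})`).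
This file is that statement in coordinates, for an abstract injective `ℚ`-linear «logarithm»
`Λ : V →ₗ[ℚ] ℚ_p` (in the application `V = E(K^D) ⊗ ℚ`, `Λ = log_ω ∘ ι ⊗ ℚ`):

* `sum_smul_eq_zero_of_charSum_eq_zero` — fields `F ⊆ k ⊆ Ω`, an injective `F`-linear `Λ : V → k`, a
  family `b : ι → Ω` linearly independent over `k`, coefficients `c t i ∈ F`, vectors `v t ∈ V`:
  `Σ_t (Σ_i c t i • b i)·Λ(v t) = 0` in `Ω` ⟹ `Σ_t c t i • v t = 0` in `V` for every `i`
  (i.e. `Σ_t v t ⊗ (Σ_i c t i b i) = 0` in `V ⊗_F (⊕ F b i)`).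
* `irreducible_cyclotomic_prime_pow_padic` — `Φ_{p^{n+1}}` is irreducible over `ℚ_p` (the tree's
  Eisenstein transport `AbsTopIII.cyclotomic_prime_pow_irreducible_of_prime` over `ℤ_p` + Gauss's lemma).
* `linearIndependent_pow_of_isPrimitiveRoot_prime_pow_padic` — for a primitive `p^{n+1}`-th root of
  unity `ζ` in a field `Ω ⊇ ℚ_p`, the powers `ζ^i`, `i < φ(p^{n+1})`, are `ℚ_p`-linearly independent.
* `sum_smul_eq_zero_of_cyclotomicCharSum_padic_eq_zero` — LEMMA I in coordinates: with `F = ℚ`,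
  `k = ℚ_p`, `b i = ζ^i`: `Σ_t (Σ_i c t i ζ^i)·Λ(v t) = 0 ⟹ ∀ i, Σ_t c t i • v t = 0`.

HONEST FRAMING: pure algebra; nothing about elliptic curves is asserted here (the memo's use — `V =
E(K^D) ⊗ ℚ`, injectivity of `log_ω ∘ ι` on it, `ζ(τ)` expanded in the power basis — is memo-level);
closes nothing, discharges no registered stub (T7); BSD is proved for no class.

References: cell memo PROOF-BDP §53.2 (LEMMA I); [cite: SerreLocalFields1979, IV §4 Prop. 17]
(`ℚ_p(ζ_{p^n})∕ℚ_p` totally ramified of degree `φ(p^n)`).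
-/

set_option autoImplicit false
set_option linter.dupNamespace false

noncomputable section

open scoped Classical

open Polynomial

namespace Summit.BirchSwinnertonDyer.BirchSwinnertonDyer.Theorems.ExceptionalCharacterInjectivity

/-- **Abstract LEMMA I (linear-disjointness form).** Fields `F ⊆ k ⊆ Ω` (a scalar tower), an `F`-vector
space `V` with an INJECTIVE `F`-linear map `Λ : V → k`, a finite family `b : ι → Ω` that is linearly
independent over `k`, coefficients `c : τ → ι → F` and vectors `v : τ → V`. If the «character sum»
`Σ_t (Σ_i c t i • b i) * Λ(v t)` vanishes in `Ω`, then for every `i` the `F`-combination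
`Σ_t c t i • v t` vanishes in `V`. Proof: regroup the sum as `Σ_i Λ(Σ_t c t i • v t) • b i`, use the
`k`-linear independence of `b`, then the injectivity of `Λ`. (In the memo: `F = ℚ`, `k = ℚ_p`,
`V = E(K^D) ⊗ ℚ`, `Λ = log_ω ∘ ι`, `b i = ζ^i`; the conclusion says `Σ_t v t ⊗ ζ(τ_t) = 0` in
`V ⊗_ℚ ℚ(ζ)`, i.e. the `ζ̄`-isotypic component of `u` is torsion.) [folklore] -/
theorem sum_smul_eq_zero_of_charSum_eq_zero {F k Ω V : Type*} [Field F] [Field k] [Field Ω]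
    [Algebra F k] [Algebra k Ω] [Algebra F Ω] [IsScalarTower F k Ω] [AddCommGroup V] [Module F V]
    (Λ : V →ₗ[F] k) (hΛ : Function.Injective Λ) {ι τ : Type*} [Fintype ι] [Fintype τ]
    (b : ι → Ω) (hb : LinearIndependent k b) (c : τ → ι → F) (v : τ → V)
    (h : ∑ t, (∑ i, c t i • b i) * algebraMap k Ω (Λ (v t)) = 0) :
    ∀ i, ∑ t, c t i • v t = 0 := by
  -- the coefficient of `b i` after regrouping is `algebraMap k Ω (Λ (Σ_t c t i • v t))`
  have key : ∀ i, algebraMap k Ω (Λ (∑ t, c t i • v t)) =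
      ∑ t, algebraMap F Ω (c t i) * algebraMap k Ω (Λ (v t)) := by
    intro i
    rw [map_sum, map_sum]
    refine Finset.sum_congr rfl fun t _ => ?_
    rw [LinearMap.map_smul, Algebra.smul_def, map_mul, ← IsScalarTower.algebraMap_apply F k Ω]
  have hre : ∑ t, (∑ i, c t i • b i) * algebraMap k Ω (Λ (v t)) =
      ∑ i, (Λ (∑ t, c t i • v t)) • b i := by
    simp_rw [Algebra.smul_def, key, Finset.sum_mul]
    rw [Finset.sum_comm]
    refine Finset.sum_congr rfl fun i _ => Finset.sum_congr rfl fun t _ => ?_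
    ring
  rw [hre] at h
  -- `k`-linear independence of `b`, then injectivity of `Λ`
  have hli := Fintype.linearIndependent_iff.1 hb (fun i => Λ (∑ t, c t i • v t)) h
  intro i
  exact hΛ (by rw [hli i, map_zero])

/-- **`Φ_{p^{n+1}}` is irreducible over `ℚ_p`** — Eisenstein at `(p) ⊆ ℤ_p` for `Φ_{p^{n+1}}(X+1)`
(the tree's `AbsTopIII.cyclotomic_prime_pow_irreducible_of_prime`, `p` being a prime element of `ℤ_p`)
and Gauss's lemma over the integrally closed `ℤ_p`. Equivalently `[ℚ_p(ζ_{p^{n+1}}) : ℚ_p] =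
φ(p^{n+1})`: `p` is totally ramified in the `p`-power cyclotomic tower.
[cite: SerreLocalFields1979, IV §4 Prop. 17] -/
theorem irreducible_cyclotomic_prime_pow_padic (p : ℕ) [Fact p.Prime] (n : ℕ) :
    Irreducible (cyclotomic (p ^ (n + 1)) ℚ_[p]) := by
  have hZ : Irreducible (cyclotomic (p ^ (n + 1)) ℤ_[p]) :=
    Literature.AnabelianGeometry.AbsoluteAnabelian.AbsTopIII.cyclotomic_prime_pow_irreducible_of_prime
      (A := ℤ_[p]) PadicInt.prime_p n
  have h := ((cyclotomic.monic (p ^ (n + 1)) ℤ_[p]).irreducible_iff_irreducible_map_fraction_map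
    (K := ℚ_[p])).1 hZ
  rwa [map_cyclotomic] at h

/-- **The power basis of `ℚ_p(ζ_{p^{n+1}})`.** For a primitive `p^{n+1}`-th root of unity `ζ` in a field
`Ω ⊇ ℚ_p`, the powers `1, ζ, …, ζ^{φ(p^{n+1}) − 1}` are linearly independent over `ℚ_p` (the minimal
polynomial of `ζ` over `ℚ_p` is `Φ_{p^{n+1}}`, of degree `φ(p^{n+1})`; Mathlib `linearIndependent_pow`).
[cite: SerreLocalFields1979, IV §4 Prop. 17] -/
theorem linearIndependent_pow_of_isPrimitiveRoot_prime_pow_padic (p : ℕ) [hp : Fact p.Prime] (n : ℕ)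
    {Ω : Type*} [Field Ω] [Algebra ℚ_[p] Ω] {ζ : Ω} (hζ : IsPrimitiveRoot ζ (p ^ (n + 1))) :
    LinearIndependent ℚ_[p] (fun i : Fin (Nat.totient (p ^ (n + 1))) => ζ ^ (i : ℕ)) := by
  haveI : NeZero ((p ^ (n + 1) : ℕ) : ℚ_[p]) :=
    ⟨by exact_mod_cast pow_ne_zero (n + 1) hp.out.ne_zero⟩
  have hmin : cyclotomic (p ^ (n + 1)) ℚ_[p] = minpoly ℚ_[p] ζ :=
    hζ.minpoly_eq_cyclotomic_of_irreducible (irreducible_cyclotomic_prime_pow_padic p n)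
  have hdeg : (minpoly ℚ_[p] ζ).natDegree = Nat.totient (p ^ (n + 1)) := by
    rw [← hmin, natDegree_cyclotomic]
  have h := linearIndependent_pow (K := ℚ_[p]) ζ
  rw [hdeg] at h
  exact h

/-- **LEMMA I in coordinates (PROOF-BDP §53.2).** `V` a `ℚ`-vector space with an INJECTIVE `ℚ`-linear
map `Λ : V → ℚ_p` (the `p`-adic logarithm along one embedding, on `E(K^D) ⊗ ℚ`), `Ω ⊇ ℚ_p` a field
containing a primitive `p^{n+1}`-th root of unity `ζ`, vectors `v : τ → V` (the conjugates `u^τ`) and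
rational coordinates `c : τ → Fin φ(p^{n+1}) → ℚ` (of the character values `ζ(τ) = Σ_i c τ i ζ^i` in
the power basis). If `Σ_τ ζ(τ)·Λ(v τ) = 0` in `Ω`, then `Σ_τ c τ i • v τ = 0` for every `i` — the
`ζ̄`-isotypic component `Σ_τ v τ ⊗ ζ(τ) ∈ V ⊗ ℚ(ζ)` vanishes. Inputs: the abstract lemma and the
`ℚ_p`-linear independence of the `ζ^i` (total ramification of `p` in `ℚ(μ_{p^{n+1}})`). [folklore] -/
theorem sum_smul_eq_zero_of_cyclotomicCharSum_padic_eq_zero (p : ℕ) [Fact p.Prime] (n : ℕ)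
    {Ω V : Type*} [Field Ω] [Algebra ℚ_[p] Ω] [Algebra ℚ Ω] [IsScalarTower ℚ ℚ_[p] Ω]
    [AddCommGroup V] [Module ℚ V] (Λ : V →ₗ[ℚ] ℚ_[p]) (hΛ : Function.Injective Λ)
    {ζ : Ω} (hζ : IsPrimitiveRoot ζ (p ^ (n + 1))) {τ : Type*} [Fintype τ]
    (c : τ → Fin (Nat.totient (p ^ (n + 1))) → ℚ) (v : τ → V)
    (h : ∑ t, (∑ i, c t i • ζ ^ (i : ℕ)) * algebraMap ℚ_[p] Ω (Λ (v t)) = 0) :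
    ∀ i, ∑ t, c t i • v t = 0 :=
  sum_smul_eq_zero_of_charSum_eq_zero Λ hΛ (fun i : Fin (Nat.totient (p ^ (n + 1))) => ζ ^ (i : ℕ))
    (linearIndependent_pow_of_isPrimitiveRoot_prime_pow_padic p n hζ) c v h

end Summit.BirchSwinnertonDyer.BirchSwinnertonDyer.Theorems.ExceptionalCharacterInjectivity

end
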